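import Summits.HodgeConjecture.HodgeConjecture.Theses.NoetherLefschetzOneUp
import Literature.AlgebraicGeometry.HodgeTheory.HyperplaneClassHardLefschetzPullback
import Literature.AlgebraicGeometry.HodgeTheory.HodgeIndexPrimitiveAlgebraicHolds
import Literature.AlgebraicGeometry.HodgeTheory.RationalClassesIndependent
import HarnessLib

/-!
# Route NoetherLefschetzOneUp · crux `K3TypeNets` (stmt-HodgeConjecture-11600) — line `registered`, stub `stub_fibreClassMultiple` (S2a)

Registered stub S2a of the lead's skeleton `Cruxes/K3TypeNets/Lines/birth.lean` (v2): the FIBREWISE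
half of the Leray edge `H⁴(X) → H⁴(X_s)` of a net `f : X ⟶ ℙ²` on a smooth projective fourfold.

**Statement.** For `X` smooth projective of dimension `4` and any `f : X ⟶ ℙ²_ℂ` there is ONE
rational algebraic class `σ ∈ H⁴(X(ℂ); ℂ)` such that on every smooth projective fibre
`X_s = fiberOver f s` (`s ∈ ℙ²(ℂ)`) every rational class `c ∈ H⁴(X(ℂ); ℂ)` restricts to a RATIONAL
multiple of `σ|_{X_s}`: `(c - q σ)|_{X_s} = 0` for some `q ∈ ℚ`.

**Proof.** Choose a closed immersion `ι : X ⟶ ℙᴺ` (`IsSmoothProjective.isProjectiveOver`) and a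
rational class `r₀` spanning `H²(ℙᴺ(ℂ); ℂ)` (`exists_isRationalClass_forall_eq_smul_projectiveSpace`),
and put `σ := ι^*(r₀ ∪ r₀)` — rational (`IsRationalClass.cup`, `.pullback`) and algebraic (classes
restricted from projective space are algebraic, `map_projectiveSpace_mem_algebraicClasses`). For a
smooth projective fibre `X_s`, the composite `κ : X_s ⟶ X ⟶ ℙᴺ` is a closed immersion (the fibre
inclusion is the base change of the closed point `s : Spec ℂ ⟶ ℙ²` of the separated `ℙ²`), so
`η := κ^* r₀` has the hard Lefschetz property in dimension `2`
(`hasHardLefschetzProperty_map_of_forall_eq_smul`, Voisin I Thm. 6.25): `L² : H⁰(X_s(ℂ)) → H⁴(X_s(ℂ))`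
is bijective, `L² 1 = η ∪ (η ∪ 1) = η ∪ η = σ|_{X_s}` (naturality of `∪`), and `H⁰(X_s(ℂ); ℂ) = ℂ · 1`
(`X_s(ℂ)` path connected). Hence `σ|_{X_s} ≠ 0` spans the line `H⁴(X_s(ℂ); ℂ)` and
`c|_{X_s} = z • σ|_{X_s}`; both being rational, `z ∈ ℚ` (`linearIndependent_of_isRationalClass`:
rational classes with no rational relation are `ℂ`-independent, Voisin I §7.1.1).

## References

* [VoisinHodgeI2002] C. Voisin, Hodge Theory and Complex Algebraic Geometry I (CUP 2002), Thm. 6.25,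
  §7.1.1, §7.1.2, §11.1.2.
* [VoisinHodgeII2003] C. Voisin, Hodge Theory and Complex Algebraic Geometry II (CUP 2003), §1.2.3
  Cor. 1.24, Prop. 9.21.
* [Arapura2022] D. Arapura, Hodge cycles and the Leray filtration, Pacific J. Math. 319 (2022), Cor. 1.4.
* [HatcherAT2002] A. Hatcher, Algebraic Topology (CUP 2002), §3.1 Thm. 3.2, §3.2 Prop. 3.10.
* [Hartshorne1977] R. Hartshorne, Algebraic Geometry (1977), II Ex. 3.11 (a), II Cor. 4.6.
-/

-- `Summit.HodgeConjecture.HodgeConjecture.Theorems` is the mandated namespace (single-problem summit),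
-- flagged by `linter.dupNamespace`; the lakefile turns the linter off tree-wide, restated here.
set_option linter.dupNamespace false

noncomputable section

open CategoryTheory AlgebraicGeometry

namespace Summit.HodgeConjecture.HodgeConjecture.Theorems

open Literature.AlgebraicGeometry.Motives Literature.AlgebraicGeometry.HodgeTheory
open Literature.AlgebraicTopology.SingularHomology Literature.Geometry.Kaehler

/-- **Two rational classes on a line differ by a rational factor**: if `c ≠ 0` and `z • c` are both
rational classes of `Hᵏ(Y; ℂ)` then `z ∈ ℚ` (rational classes satisfying a complex linear relation
satisfy a rational one, `linearIndependent_of_isRationalClass` — the injectivity of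
`Hᵏ(Y; ℚ) ⊗ ℂ → Hᵏ(Y; ℂ)`). [cite: VoisinHodgeI2002, §7.1.1] [cite: HatcherAT2002, §3.1 Thm. 3.2] -/
private theorem exists_ratCast_eq_of_isRationalClass_smul_fibre {Y : Type} [TopologicalSpace Y]
    {k : ℕ} {c : singularCohomology ℂ ℂ Y k} (hc : IsRationalClass c) (hc0 : c ≠ 0) {z : ℂ}
    (hz : IsRationalClass (z • c)) : ∃ q : ℚ, (q : ℂ) = z := by
  -- adapted from `Literature.AlgebraicGeometry.Motives.exists_ratCast_eq_of_isRationalClass_smul`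
  -- (file `Motives/SegreHyperplaneClass`, not imported: heavy import cone)
  classical
  by_contra hcon
  push Not at hcon
  have hind : LinearIndependent ℂ ![c, z • c] := by
    refine linearIndependent_of_isRationalClass (fun j ↦ ?_) fun q hq ↦ ?_
    · fin_cases j
      · exact hc
      · exact hz
    · rw [Fin.sum_univ_two] at hq
      simp only [Matrix.cons_val_zero, Matrix.cons_val_one, Matrix.cons_val_fin_one] at hq
      have h' : ((q 0 : ℂ) + (q 1 : ℂ) * z) • c = 0 := by rw [add_smul, mul_smul, hq]
      have hcoef : (q 0 : ℂ) + (q 1 : ℂ) * z = 0 := (smul_eq_zero.1 h').resolve_right hc0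
      by_cases hq1 : q 1 = 0
      · have hq0 : (q 0 : ℂ) = 0 := by
          rw [hq1, Rat.cast_zero, zero_mul, add_zero] at hcoef; exact hcoef
        funext j
        fin_cases j
        · exact_mod_cast hq0
        · exact hq1
      · exfalso
        refine hcon (-q 0 / q 1) ?_
        have hq1' : ((q 1 : ℚ) : ℂ) ≠ 0 := by exact_mod_cast hq1
        push_cast
        field_simp
        linear_combination -hcoef
  have h := (LinearIndependent.pair_iff.1 hind) z (-1) (by rw [neg_one_smul, add_neg_cancel])
  exact one_ne_zero (neg_eq_zero.1 h.2)

/-- The fibre inclusion `X_s ⟶ X` of `f : X ⟶ ℙᵐ_ℂ` over a complex point `s` is a closed immersion: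
the base change of the closed point `s : Spec ℂ ⟶ ℙᵐ` (a section of the separated `ℙᵐ ⟶ Spec ℂ`).
[cite: Hartshorne1977, II Ex. 3.11 (a) and Cor. 4.6] -/
private theorem isClosedImmersion_fiberι_projectiveSpace_left {m : ℕ} {X : SchemeOver ℂ}
    (f : X ⟶ projectiveSpace m ℂ) (s : AlgPoints (projectiveSpace m ℂ) ℂ) :
    IsClosedImmersion (fiberι f s).left := by
  -- adapted from `HodgeTheory.isClosedImmersion_fiberι_proj_left` (file `LinearSectionPencilFibres`)
  haveI := CurveNet.isSeparated_projectiveSpace_hom m ℂ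
  haveI : IsClosedImmersion s.left := CurveNet.isClosedImmersion_left_of_isSeparated s
  rw [fiberι_left]
  exact MorphismProperty.pullback_fst (P := @IsClosedImmersion) _ _ inferInstance

/-- **Stub S2a — fibrewise calibration by a multisection class** (crux `K3TypeNets`, line
`registered`; the fibrewise half of the Leray edge `H⁴(X) → H⁴(X_s)`). For `X` smooth projective of
dimension `4` and any `f : X ⟶ ℙ²` there is ONE rational algebraic class `σ ∈ H⁴(X(ℂ); ℂ)` —
`σ = ι^*(r₀ ∪ r₀) = h ∪ h`, `h = ι^* r₀`, for a closed immersion `ι : X ⟶ ℙᴺ` and a rational generator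
`r₀` of `H²(ℙᴺ(ℂ); ℂ)`; algebraic as a class restricted from projective space — such that on EVERY
smooth projective fibre `X_s = fiberOver f s` every rational `c ∈ H⁴(X(ℂ); ℂ)` restricts to a RATIONAL
multiple of `σ|_{X_s}`: `σ|_{X_s} = L² 1 ≠ 0` spans the line `H⁴(X_s(ℂ); ℂ)` (hard Lefschetz for the
restricted hyperplane class of the surface `X_s ↪ X ↪ ℙᴺ`, Voisin I Thm. 6.25, and
`H⁰(X_s(ℂ); ℂ) = ℂ · 1`), and a rational class which is a complex multiple of a non-zero rational
class is a rational multiple of it (Voisin I §7.1.1).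
[cite: VoisinHodgeI2002, Thm. 6.25, §7.1.1 and §7.1.2] [cite: VoisinHodgeII2003, §1.2.3 Cor. 1.24 and Prop. 9.21]
[cite: Arapura2022, Cor. 1.4 (the edge `H⁰(U, R⁴f_*ℚ)`)] [cite: HatcherAT2002, §3.2 Prop. 3.10] -/
theorem stub_fibreClassMultiple :
    ∀ ⦃X : SchemeOver ℂ⦄ (f : X ⟶ projectiveSpace 2 ℂ), IsSmoothProjective 4 X →
      ∃ σ : complexBetti X (2 * 2), IsRationalClass σ ∧ σ ∈ algebraicClasses X 2 ∧
        ∀ s : AlgPoints (projectiveSpace 2 ℂ) ℂ, IsSmoothProjective 2 (fiberOver f s) →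
          ∀ c : complexBetti X (2 * 2), IsRationalClass c →
            ∃ q : ℚ, complexBetti.map (fiberι f s) (2 * 2) (c - (q : ℂ) • σ) = 0 := by
  intro X f hX
  have h22 : 2 + 2 = 2 * 2 := rfl
  have h02 : 0 + 2 * 1 = 2 := rfl
  have h04 : 0 + 2 * 2 = 2 * 2 := rfl
  -- a projective embedding `ι : X ⟶ ℙᴺ` and a rational generator `r₀` of `H²(ℙᴺ(ℂ); ℂ)`
  obtain ⟨N, ι, hι⟩ := hX.isProjectiveOver
  haveI := hι
  obtain ⟨r₀, hr₀Q, hgen⟩ := exists_isRationalClass_forall_eq_smul_projectiveSpace N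
  -- `σ := ι^*(r₀ ∪ r₀)`: rational and algebraic
  refine ⟨complexBetti.map ι (2 * 2) (cupProduct h22 r₀ r₀), (hr₀Q.cup h22 hr₀Q).pullback _,
    map_projectiveSpace_mem_algebraicClasses hX ι 2 _, ?_⟩
  intro s hs c hcQ
  -- the closed immersion `κ : X_s ⟶ X ⟶ ℙᴺ` and the restricted class `η := κ^* r₀`
  haveI := isClosedImmersion_fiberι_projectiveSpace_left f s
  haveI : IsClosedImmersion (fiberι f s ≫ ι).left := by
    rw [Over.comp_left]
    infer_instance
  have hHL : HasHardLefschetzProperty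
      (singularCohomology.map ℂ ℂ (AlgPoints.mapContinuous (L := ℂ) (fiberι f s ≫ ι)) 2 r₀) 2 :=
    hasHardLefschetzProperty_map_of_forall_eq_smul hs (fiberι f s ≫ ι) hgen
  have hηQ : IsRationalClass
      (singularCohomology.map ℂ ℂ (AlgPoints.mapContinuous (L := ℂ) (fiberι f s ≫ ι)) 2 r₀) :=
    hr₀Q.pullback _
  set η : complexBetti (fiberOver f s) 2 :=
    singularCohomology.map ℂ ℂ (AlgPoints.mapContinuous (L := ℂ) (fiberι f s ≫ ι)) 2 r₀ with hηdef
  -- `σ|_{X_s} = η ∪ η` (functoriality and naturality of the cup product)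
  have hσs : complexBetti.map (fiberι f s) (2 * 2) (complexBetti.map ι (2 * 2) (cupProduct h22 r₀ r₀)) =
      cupProduct h22 η η := by
    have hc : complexBetti.map (fiberι f s) (2 * 2) (complexBetti.map ι (2 * 2) (cupProduct h22 r₀ r₀)) =
        complexBetti.map (fiberι f s ≫ ι) (2 * 2) (cupProduct h22 r₀ r₀) := by
      rw [complexBetti.map_comp]
      rfl
    rw [hc]
    exact cupProduct_map _ h22 r₀ r₀
  -- hard Lefschetz on the surface `X_s`: `L² : H⁰ → H⁴` is bijective and `L² 1 = η ∪ η`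
  have hL2 : lefschetzPowTo η 2 0 (2 * 2) h04 (singularCohomology.one ℂ (ComplexPoints (fiberOver f s))) =
      cupProduct h22 η η := by
    rw [lefschetzPowTo_succ_apply η 1 0 2 (2 * 2) h02 h04 h22,
      lefschetzPowTo_succ_apply η 0 0 0 2 rfl h02 rfl, lefschetzPowTo_zero_apply,
      lefschetzOperator_apply, lefschetzOperator_apply, cupProduct_one]
  have hbij : Function.Bijective (lefschetzPowTo η 2 0 (2 * 2) h04) :=
    bijective_lefschetzPowTo_of_hasHardLefschetz η hHL (show 0 + 2 = 2 from rfl) (2 * 2) h04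
  -- `σ|_{X_s} ≠ 0` (`1 ≠ 0` in `H⁰` of the path-connected `X_s(ℂ)`)
  have hσs0 : cupProduct h22 η η ≠ 0 := by
    intro h0
    refine singularCohomology_one_complexPoints_ne_zero hs (hbij.1 ?_)
    rw [hL2, h0, map_zero]
  -- `c|_{X_s} = z • σ|_{X_s}`: `H⁴(X_s(ℂ); ℂ) = L²(ℂ · 1)`
  haveI := pathConnectedSpace_complexPoints_of_isSmoothProjective hs
  obtain ⟨a, ha⟩ := hbij.2 (complexBetti.map (fiberι f s) (2 * 2) c)
  obtain ⟨z, rfl⟩ :=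
    Literature.Topology.FourManifolds.ComplexProjectiveSpace.exists_eq_smul_one (K := ℂ) a
  rw [map_smul, hL2] at ha
  -- both classes are rational, so `z ∈ ℚ`
  have hσsQ : IsRationalClass (cupProduct h22 η η) := hηQ.cup h22 hηQ
  have hcsQ : IsRationalClass (z • cupProduct h22 η η) := by
    rw [ha]
    exact hcQ.pullback _
  obtain ⟨q, hq⟩ := exists_ratCast_eq_of_isRationalClass_smul_fibre hσsQ hσs0 hcsQ
  refine ⟨q, ?_⟩
  rw [map_sub, map_smul, hσs, hq, ha, sub_self]

end Summit.HodgeConjecture.HodgeConjecture.Theorems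

end
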